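import Summits.AtomisticToContinuum.Crystallization.Theorems.ExcessDecayLiouvilleSiteGeometry

/-!
# Route `ExcessDecayLiouville`: a preliminary of the decay step (nonlinear half, XVI a)

Harmonic-replacement architecture for item `ExcessDecay` (stmt-AtomisticToContinuum-9334), nonlinear half.
* `taylor_error_pointwise` : the `∀ radius` Taylor bound of `linear_decay` gives the pointwise error
  `‖h x − T x‖ ≤ 1428 √Θ₂ dist(x, p₀)²` at every site of `B_ρ(c₀)` (site-dependent degree `N`).
All `[folklore]`; helper lemmas, nothing here closes an item.
-/

noncomputable section

namespace Summit.AtomisticToContinuum.Crystallization.Theorems.ExcessDecayLiouville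

open scoped BigOperators Topology Classical
open Literature.MathematicalPhysics.StatisticalMechanics
open Summit.AtomisticToContinuum.Crystallization.Theorems.PhononStabilityNegative

local notation "E3" => EuclideanSpace ℝ (Fin 3)

/-! ## Pointwise Taylor error with a site-dependent degree -/

/-- **Pointwise Taylor error**: if `‖E(t m + Az)‖² ≤ 144 N⁴ Θ` whenever `dist ≤ L`, `400/189 (L + 11/5) ≤ N`
and `4N + 11 ≤ 9ρ` (`ρ ≥ 64`), then `‖E x‖ ≤ 1428 √Θ dist(x, p₀)²` at every site `x ≠ p₀` of `B_ρ(c₀)`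
(`dist p₀ c₀ ≤ 11/10`). [folklore] -/
theorem taylor_error_pointwise {t : Fin 2 → E3} {A : E3 →L[ℝ] E3} (hA : Adm₀ A) (hI : Inner₀ t A)
    (E : E3 → E3) {c₀ p₀ : E3} (hp₀ : p₀ ∈ Sites₀ t A) (hp₀c : dist p₀ c₀ ≤ 11 / 10)
    {ρ Θ : ℝ} (hρ : 64 ≤ ρ) (hΘ : 0 ≤ Θ)
    (htay : ∀ (L : ℝ) (N : ℕ), 400 / 189 * (L + 11 / 5) ≤ N → 4 * (N : ℝ) + 11 ≤ 9 * ρ →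
      ∀ (m : Fin 2) (z : E3), z ∈ Λ₀ → dist (t m + A z) c₀ ≤ L → ‖E (t m + A z)‖ ^ 2 ≤ 144 * (N : ℝ) ^ 4 * Θ) :
    ∀ x ∈ Sites₀ t A, x ≠ p₀ → dist x c₀ ≤ ρ → ‖E x‖ ≤ 1428 * Real.sqrt Θ * (dist x p₀) ^ 2 := by
  intro x hx hxp hxc
  obtain ⟨m, z, hz, rfl⟩ := hx
  have hd := dist_sites_ge hA hI ⟨m, z, hz, rfl⟩ hp₀ hxp
  set d := dist (t m + A z) p₀ with hd_def
  set N : ℕ := ⌈400 / 189 * (dist (t m + A z) c₀ + 11 / 5)⌉₊ with hN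
  have hy0 : 0 ≤ 400 / 189 * (dist (t m + A z) c₀ + 11 / 5) := by positivity
  have hN1 : 400 / 189 * (dist (t m + A z) c₀ + 11 / 5) ≤ N := Nat.le_ceil _
  have hN2 : (N : ℝ) < 400 / 189 * (dist (t m + A z) c₀ + 11 / 5) + 1 := Nat.ceil_lt_add_one hy0
  have hdc : dist (t m + A z) c₀ ≤ d + 11 / 10 := by
    have := dist_triangle (t m + A z) p₀ c₀; linarith
  have hNd : (N : ℝ) ≤ 109 / 10 * d := by nlinarith
  have hN4 : 4 * (N : ℝ) + 11 ≤ 9 * ρ := by nlinarith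
  have h := htay (dist (t m + A z) c₀) N hN1 hN4 m z hz le_rfl
  have hN0 : 0 ≤ (N : ℝ) := Nat.cast_nonneg _
  have hsq : ‖E (t m + A z)‖ ^ 2 ≤ (12 * (N : ℝ) ^ 2 * Real.sqrt Θ) ^ 2 := by
    calc ‖E (t m + A z)‖ ^ 2 ≤ 144 * (N : ℝ) ^ 4 * Θ := h
      _ = (12 * (N : ℝ) ^ 2 * Real.sqrt Θ) ^ 2 := by
          rw [mul_pow, mul_pow, Real.sq_sqrt hΘ]; ring
  have h1 : ‖E (t m + A z)‖ ≤ 12 * (N : ℝ) ^ 2 * Real.sqrt Θ :=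
    pow_le_pow_iff_left₀ (norm_nonneg _) (by positivity) (by norm_num : (2 : ℕ) ≠ 0) |>.1 hsq
  refine h1.trans ?_
  have hs0 : 0 ≤ Real.sqrt Θ := Real.sqrt_nonneg _
  have hN2d : (N : ℝ) ^ 2 ≤ (109 / 10 * d) ^ 2 := pow_le_pow_left₀ hN0 hNd 2
  calc 12 * (N : ℝ) ^ 2 * Real.sqrt Θ ≤ 12 * (109 / 10 * d) ^ 2 * Real.sqrt Θ := by gcongr
    _ = (12 * (109 / 10 : ℝ) ^ 2) * Real.sqrt Θ * d ^ 2 := by ring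
    _ ≤ 1428 * Real.sqrt Θ * d ^ 2 := by gcongr; norm_num

end Summit.AtomisticToContinuum.Crystallization.Theorems.ExcessDecayLiouville

end
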